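import Literature.NumberTheory.EllipticCurves.KellerYin2024.AnomalousImprimitiveLambdaInvariants
import Summits.BirchSwinnertonDyer.BirchSwinnertonDyer.Theorems.EisensteinPrimesXAcImprimitiveLambdaShift
import Summits.BirchSwinnertonDyer.BirchSwinnertonDyer.Theorems.EisensteinPrimesUnrSelmerImprimitiveLambdaShift
import HarnessLib

/-!
# Route `EisensteinPrimes` (rung K5), crux 2 `GoodLatticeBDPValue`, line `halves`, stub `stub_alg`:
# Keller–Yin Thm. 1.5.1 [ALG] FROM Thm. 1.4.1 [ALG-imp] and the three `S`-relaxation inputs — IN THE KERNEL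

Cell `bsd-eis` (FULL-BSD rank ≤ 1 programme, home `run/shared/lean/pub/bsd-eis/`), seat `bsd-eis-k5-c2`
g11, OPTION (B0) of planner RULINGS L94 ADDENDUM (6) / L95. The line `halves` (skeleton v10
f3e5522201cf08f1) proves the crux `GoodLatticeBDPValue` BY NAME from 15 PUBLISHED named facts + [ALG]
`KellerYin2024.thm151_algmain_goodLattice_OPEN` (KY Thm. 1.5.1, PREPRINT) + [AN]-DS-Free
(`Theorems.GoodLatticeBDPValueHalves.goodLatticeBDPValue_of_pub_of_pre`, p559301). Keller–Yin's proof of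
Thm. 1.5.1 (arXiv:2402.12781v2 TeX L1358–1360) reads, in full: "With our Thm. 1.4.1 and Rem. 1.4.2,
the proof is the same as that of [CGLS, Theorem 1.5.1]." This file IS that sentence in the kernel:

  `thm151_of_thm141 : thm141_imprimlambda_goodLattice_OPEN → thm122_rubinHida_residualPair_unrSelmer →
     prop125_residualPair_unrSelmer_imprimitive → rem142_goodLattice_selmerAc_imprimitive →
     thm151_algmain_goodLattice_OPEN`

i.e. [ALG] ⇐ [ALG-imp] (KY Thm. 1.4.1 = the cell's located GAP line (⋆) A7 of TARGET row A1, PRE) +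
[RH] (Rubin 1991 ∘ Hida 2010 cotorsion of the character Selmer groups, KY/CGLS Thm. 1.2.2) + [PWL-θ]
(Pollack–Weston A.2 ∘ Lemma 1.1.1: `𝔛_θ^S` f.g. torsion `μ = 0` and `corank_{ℤ_p}(H¹_{𝓕_nr^S}/H¹_{𝓕_nr})
= Σ_{w∈S} λ𝒫_w(θ)`, KY/CGLS Prop. 1.2.5) + [PWL-f] (the same for `f`: CGLS proof of Thm. 1.5.1 /
KY Rem. 1.4.2), with the `λ`-ADDITIVITY along the dual restrictions supplied by the kernel theorems
`XAcImprimitiveLambdaShift.lambdaInvariant_eq_add_zpCorank_of_muInvariant_eq_zero` (p564629, Castella's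
`XAc`) and `UnrSelmerImprimitiveLambdaShift.lambdaInvariant_eq_add_zpCorank_of_muInvariant_eq_zero`
(p565030, generic character module). Arithmetic: `λ(𝔛^S_f) + ε = λ(𝔛^S_ω̃) + λ(𝔛^S_𝟙̃)`,
`λ(𝔛^S_?) = λ(𝔛_?) + Σ_{w∈S} λ𝒫_w(?)` for `? ∈ {f, ω̃, 𝟙̃}` ⟹ `λ(𝔛_f) + ε + Σ λ𝒫_w(f) = λ(𝔛_ω̃) +
λ(𝔛_𝟙̃) + Σ (λ𝒫_w(ω̃) + λ𝒫_w(𝟙̃))` (`ℕ`, no subtraction), plus "`𝔛_f` f.g. torsion `μ = 0`" verbatim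
from Thm. 1.4.1's last clause.

HONEST FRAMING: CONDITIONAL on the four named inputs (audit `proof.conditional` on exactly these); the
PREPRINT content of [ALG] is thereby confined to KY Thm. 1.4.1 (the audited gap line) — cosmetic for
counts, exact for the record (RULING L94 ADD (6)). Nothing is booked; BSD is proved for no curve; no
label or count moves. Helper attached to stmt-BirchSwinnertonDyer-19032 (`--supports`); the skeleton
`halves` v11 replaces `stub_alg` by `stub_imprim` (PRE) + `stub_rubinHida` + `stub_imprimCorank`.

References: [KellerYin2024] Thm. 1.4.1 (L1087–1098), Rem. 1.4.2 (L1130–1140), Thm. 1.5.1 + proof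
(L1346–1360), Thm. 1.2.2, Prop. 1.2.5, Lemma 1.1.1; [CastellaGrossiLeeSkinner2022] Thm. 1.5.1 + proof
(L909–931), Prop. 1.2.5, Lemma 1.1.1, L893–901; [PollackWeston2011] App. A Prop. A.2; HOME/k5-c2-MEMO-10.md §5,
HOME/k5-c2-MEMO-11.md.
-/

set_option linter.dupNamespace false
set_option autoImplicit false

noncomputable section

open scoped Classical

open NumberField IsDedekindDomain Field
open Literature.NumberTheory.EllipticCurves Literature.NumberTheory.EllipticCurves.GreenbergSelmer
  Literature.NumberTheory.EllipticCurves.GreenbergVatsal2000 Literature.NumberTheory.GaloisRepresentations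
  Literature.NumberTheory.EllipticCurves.Castella2018 Literature.NumberTheory.EllipticCurves.KellerYin2024
open Summit.BirchSwinnertonDyer.BirchSwinnertonDyer.Theorems

namespace Summit.BirchSwinnertonDyer.BirchSwinnertonDyer.Theorems.GoodLatticeAlgMainOfImprimitive

/-- **Keller–Yin Thm. 1.5.1 [ALG] from Thm. 1.4.1 [ALG-imp] and the three `S`-relaxation inputs** —
KY's one-line proof of Thm. 1.5.1 ("With our Thm. 1.4.1 and Rem. 1.4.2, the proof is the same as that
of [CGLS, Theorem 1.5.1]") in the kernel: instantiate [ALG-imp] at any imprimitive character dual data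
(they exist: `nonempty_unrDualData_char`), read off `𝔛_f` f.g. torsion `μ = 0`, and combine the
imprimitive identity `λ(𝔛^S_f) + ε = λ(𝔛^S_ω̃) + λ(𝔛^S_𝟙̃)` with the three shifts
`λ(𝔛^S_?) = λ(𝔛_?) + corank_{ℤ_p}(Sel^S/Sel)` (kernel: `XAcImprimitiveLambdaShift`,
`UnrSelmerImprimitiveLambdaShift`, each fed the `μ = 0` of the imprimitive dual) and the three corank
VALUES `Σ_{w∈S} λ𝒫_w(?)` ([PWL-θ] twice, [PWL-f]); `Σ (a + b) = Σ a + Σ b` and `omega`. CONDITIONAL on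
the four named statements; nothing booked. [claim: KellerYin2024, status: under-review]
[cite: KellerYin2024, Thm. 1.5.1 and its proof (arXiv:2402.12781v2 TeX L1346–1360), Thm. 1.4.1 (L1087–1098), Rem. 1.4.2 (L1130–1140)]
[cite: CastellaGrossiLeeSkinner2022, proof of Thm. 1.5.1 (MAINalgside; arXiv:2008.02571v2 TeX L909–931)]
[cite: PollackWeston2011, App. A Prop. A.2] -/
theorem thm151_of_thm141
    (h141 : thm141_imprimlambda_goodLattice_OPEN)
    (h122 : thm122_rubinHida_residualPair_unrSelmer)
    (h125 : prop125_residualPair_unrSelmer_imprimitive)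
    (h142 : rem142_goodLattice_selmerAc_imprimitive) :
    thm151_algmain_goodLattice_OPEN := by
  intro W _ _ p _ hp hgood hred hanom hlat K _ _ hK hH hHp htor ι v vbar hv hvbar hne κ hκ γ _ θsub θquot
    hpair Sf hSf Dsub Dquot
  have hγ : κ.IsTopGenerator γ := Fact.out
  -- imprimitive dual data of the two characters exist
  obtain ⟨DSsub⟩ := nonempty_unrDualData_char (∅ : Set (PadicAlgCl p)) θsub κ vbar
    (↑Sf : Set (HeightOneSpectrum (𝓞 K))) hγ
  obtain ⟨DSquot⟩ := nonempty_unrDualData_char (∅ : Set (PadicAlgCl p)) θquot κ vbar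
    (↑Sf : Set (HeightOneSpectrum (𝓞 K))) hγ
  -- [ALG-imp] KY Thm. 1.4.1
  obtain ⟨⟨hfgS, htorS, hμS⟩, ⟨hfg0, htor0, hμ0⟩, hlam⟩ := h141 W p hp hgood hred hanom hlat K hK hH hHp
    htor ι v vbar hv hvbar hne κ hκ γ θsub θquot hpair Sf hSf DSsub DSquot
  -- [RH] and [PWL-θ] for both characters, [PWL-f]
  obtain ⟨hRHsub, hRHquot⟩ := h122 W p hp hgood hred hanom hlat K hK hH hHp htor ι v vbar hv hvbar hne κ
    hκ γ θsub θquot hpair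
  obtain ⟨hSsub, hcsub⟩ := h125 W p hp hgood hred hanom hlat K hK hH hHp htor ι v vbar hv hvbar hne κ hκ
    γ θsub θquot hpair Sf hSf θsub (Or.inl rfl) hRHsub
  obtain ⟨hSquot, hcquot⟩ := h125 W p hp hgood hred hanom hlat K hK hH hHp htor ι v vbar hv hvbar hne κ
    hκ γ θsub θquot hpair Sf hSf θquot (Or.inr rfl) hRHquot
  have hcf := h142 W p hp hgood hred hanom hlat K hK hH hHp htor ι v vbar hv hvbar hne κ hκ γ Sf hSf
    hfg0 htor0
  -- the three kernel `λ`-shifts, each fed the `μ = 0` of the imprimitive dual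
  haveI := hfgS
  obtain ⟨-, -, -, -, hshiftf⟩ :=
    XAcImprimitiveLambdaShift.lambdaInvariant_eq_add_zpCorank_of_muInvariant_eq_zero (W.baseChange K) p
      κ vbar γ (Set.empty_subset (↑Sf : Set (HeightOneSpectrum (𝓞 K)))) htorS hμS
  obtain ⟨hfgSsub, htorSsub, hμSsub⟩ := hSsub DSsub
  obtain ⟨hfgSquot, htorSquot, hμSquot⟩ := hSquot DSquot
  haveI := hfgSsub
  haveI := hfgSquot
  obtain ⟨-, -, -, -, hshiftsub⟩ :=
    UnrSelmerImprimitiveLambdaShift.lambdaInvariant_eq_add_zpCorank_of_muInvariant_eq_zero κ vbar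
      (exists_pow_smul_cofree_eq_zero (∅ : Set (PadicAlgCl p)) θsub)
      (isOpen_stabilizer_cofree (∅ : Set (PadicAlgCl p)) θsub) hγ
      (Set.empty_subset (↑Sf : Set (HeightOneSpectrum (𝓞 K)))) DSsub htorSsub hμSsub Dsub
  obtain ⟨-, -, -, -, hshiftquot⟩ :=
    UnrSelmerImprimitiveLambdaShift.lambdaInvariant_eq_add_zpCorank_of_muInvariant_eq_zero κ vbar
      (exists_pow_smul_cofree_eq_zero (∅ : Set (PadicAlgCl p)) θquot)
      (isOpen_stabilizer_cofree (∅ : Set (PadicAlgCl p)) θquot) hγ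
      (Set.empty_subset (↑Sf : Set (HeightOneSpectrum (𝓞 K)))) DSquot htorSquot hμSquot Dquot
  -- assemble
  refine ⟨hfg0, htor0, hμ0, ?_⟩
  rw [Finset.sum_add_distrib]
  rw [hcf] at hshiftf
  rw [hcsub] at hshiftsub
  rw [hcquot] at hshiftquot
  generalize (if ∀ σ : absoluteGaloisGroup K, θquot σ = 1 then 1 else 0) = e at hlam ⊢
  omega

end Summit.BirchSwinnertonDyer.BirchSwinnertonDyer.Theorems.GoodLatticeAlgMainOfImprimitive

end
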